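import Literature.NumberTheory.GaloisRepresentations.RayClassGroupPrimePowerKernel
import Literature.NumberTheory.NumberFields.RayClassFieldGaloisGroup
import Literature.NumberTheory.ComplexMultiplication.EllipticUnits.KatoLayerArtinCompatibility
import Literature.AnabelianGeometry.EtaleTheta.SettingGalois
import Mathlib.FieldTheory.Relrank
import HarnessLib

/-!
# `[K(𝔣𝔭^{n+1}) : K(𝔣𝔭)] = p^n` at a prime `𝔭` of degree one unramified over `p`
# (de Shalit 1987, II.1.9: `Gal(K(𝔣𝔭^{n+1})/K(𝔣𝔭)) ≅ (1+𝔭)/(1+𝔭^{n+1})`, of order `p^n`)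

De Shalit, *Iwasawa theory of elliptic curves with complex multiplication* (1987), II.1.9 (p. 43) and
II.4.6 (p. 59): for an imaginary quadratic `K`, a split prime `𝔭` above `p` (`𝒪_𝔭 = ℤ_p`) and an
integral ideal `𝔣` prime to `𝔭` with `w_𝔣 = 1`, the ray class fields `K(𝔣𝔭^{n+1})` form a tower over
`K(𝔣𝔭)` with `Gal(K(𝔣𝔭^{n+1})/K(𝔣𝔭)) ≅ (1 + 𝔭𝒪_𝔭)/(1 + 𝔭^{n+1}𝒪_𝔭) ≅ (1 + pℤ_p)/(1 + p^{n+1}ℤ_p)`,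
cyclic of order `p^n`; in particular `[K(𝔣𝔭^{n+1}) : K(𝔣𝔭)] = p^n` and the relative index of the
fixing subgroups `Gal(K̄/K(𝔣𝔭^{n+1})) ≤ Gal(K̄/K(𝔣𝔭))` inside `Gal(K̄/K)` is `p^n`.

This file converts the ray class NUMBER identity `#Cl_K^{𝔣𝔭^{n+1}} = #Cl_K^{𝔣𝔭} · p^n`
(`GaloisRepresentations.natCard_rayClassGroup_mul_pow_eq`, stated for any totally complex `K`, any
prime `𝔭` of residue degree one unramified over `p`, `𝔣 ≠ 0` prime to `𝔭` and `w_{𝔣𝔭} = 1`) into the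
DEGREE statements, via `[C_𝔪 : K] = #Cl_K^𝔪` (`finrank_rayClassField`) and the tower law:

* `rayClassField_le_of_le` — `C_𝔪 ≤ C_{𝔪'}` for `0 ≠ 𝔪' ≤ 𝔪`;
* `finrank_rayClassField_mul_pow_succ_eq` — `[K(𝔣𝔭^{n+1}) : K] = [K(𝔣𝔭) : K] · p^n`;
* ★ `relfinrank_rayClassField_mul_pow_succ` — **`[K(𝔣𝔭^{n+1}) : K(𝔣𝔭)] = p^n`** (as
  `IntermediateField.relfinrank`, and as `finrank` over `K(𝔣𝔭)` of the extended-scalars field: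
  `finrank_extendScalars_rayClassField_mul_pow_succ`);
* `relfinrank_rayClassField_mul_pow_succ_succ` — consecutive layers: `[K(𝔣𝔭^{n+2}) : K(𝔣𝔭^{n+1})] = p`;
* ★ `relIndex_fixingSubgroup_rayClassField_mul_pow_succ` — **the Galois form**:
  `[Gal(K̄/K(𝔣𝔭)) : Gal(K̄/K(𝔣𝔭^{n+1}))] = p^n` inside `Gal(K̄/K) = AlgebraicClosure K ≃ₐ[K] _`
  (`SettingGalois.relIndex_fixingSubgroup_eq_finrank`), the `hidx` input of
  `SubgroupTower.exists_toZModPow_character_eq_of_relIndex` for the ray class tower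
  `U n = Gal(K̄/K(𝔣𝔭^{n+1}))`; and `relIndex_fixingSubgroup_rayClassField_mul_pow_succ_succ` (`= p`
  between consecutive layers).

Everything is a theorem; no definitions, no named facts, no instances, no `sorry`.
-/

noncomputable section

open NumberField IsDedekindDomain IsDedekindDomain.HeightOneSpectrum IntermediateField Module

namespace Literature.NumberTheory.NumberFields

open Literature.NumberTheory.GaloisRepresentations
open Literature.NumberTheory.ComplexMultiplication.EllipticUnits (rayUnitIdeles_anti_of_le)

variable {K : Type} [Field K] [NumberField K]

/-- `C_𝔪 ≤ C_{𝔪'}` for `0 ≠ 𝔪' ≤ 𝔪` (`𝔪 ∣ 𝔪'`): the ray class fields increase with the modulus.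
[cite: NeukirchANT1999, Ch. VI §6 Def. (6.2)] [cite: deShalit1987, II.1.9 (p. 43)] -/
theorem rayClassField_le_of_le {𝔪 𝔪' : Ideal (𝓞 K)} (h𝔪' : 𝔪' ≠ ⊥) (h : 𝔪' ≤ 𝔪) :
    rayClassField K 𝔪 ≤ rayClassField K 𝔪' :=
  rayClassField_mono (rayUnitIdeles_anti_of_le h𝔪' h)

/-- `K(𝔣𝔭) ≤ K(𝔣𝔭^{n+1})`. [cite: deShalit1987, II.1.9 (p. 43)] -/
theorem rayClassField_mul_le_mul_pow_succ (v : HeightOneSpectrum (𝓞 K)) {𝔣 : Ideal (𝓞 K)}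
    (h𝔣 : 𝔣 ≠ ⊥) (n : ℕ) :
    rayClassField K (𝔣 * v.asIdeal) ≤ rayClassField K (𝔣 * v.asIdeal ^ (n + 1)) :=
  rayClassField_le_of_le (mul_ne_zero h𝔣 (pow_ne_zero _ v.ne_bot))
    (Ideal.mul_mono_right (Ideal.pow_le_self (Nat.succ_ne_zero n)))

/-- `K(𝔣𝔭^{n+1}) ≤ K(𝔣𝔭^{n+2})`. [cite: deShalit1987, II.1.9 (p. 43)] -/
theorem rayClassField_mul_pow_succ_le_succ (v : HeightOneSpectrum (𝓞 K)) {𝔣 : Ideal (𝓞 K)}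
    (h𝔣 : 𝔣 ≠ ⊥) (n : ℕ) :
    rayClassField K (𝔣 * v.asIdeal ^ (n + 1)) ≤ rayClassField K (𝔣 * v.asIdeal ^ (n + 2)) :=
  rayClassField_le_of_le (mul_ne_zero h𝔣 (pow_ne_zero _ v.ne_bot))
    (Ideal.mul_mono_right (Ideal.pow_le_pow_right (Nat.le_succ _)))

section DegreeOne

variable [IsTotallyComplex K] (v : HeightOneSpectrum (𝓞 K)) {p : ℕ} [Fact p.Prime]
  (hdeg : Nat.card (𝓞 K ⧸ v.asIdeal) = p)
  (hval : v.intValuation ((p : ℕ) : 𝓞 K) = WithZero.exp (-1 : ℤ))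
  {𝔣 : Ideal (𝓞 K)} (h𝔣 : 𝔣 ≠ ⊥) (hcop : IsCoprime 𝔣 v.asIdeal)
  (hw : ∀ u : (𝓞 K)ˣ, (u : 𝓞 K) - 1 ∈ 𝔣 * v.asIdeal → u = 1)
include hdeg hval h𝔣 hcop hw

/-- `[K(𝔣𝔭^{n+1}) : K] = [K(𝔣𝔭) : K] · p^n` for `K` totally complex, `𝔭` of degree one unramified over
`p`, `𝔣 ≠ 0` prime to `𝔭`, `w_{𝔣𝔭} = 1`. [cite: deShalit1987, II.1.9 (p. 43)]
[cite: NeukirchANT1999, Ch. VI §6 Def. (6.2)] -/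
theorem finrank_rayClassField_mul_pow_succ_eq (n : ℕ) :
    finrank K (rayClassField K (𝔣 * v.asIdeal ^ (n + 1))) =
      finrank K (rayClassField K (𝔣 * v.asIdeal)) * p ^ n := by
  rw [finrank_rayClassField (mul_ne_zero h𝔣 (pow_ne_zero _ v.ne_bot)),
    finrank_rayClassField (mul_ne_zero h𝔣 v.ne_bot),
    natCard_rayClassGroup_mul_pow_eq v hdeg hval h𝔣 hcop hw n]

/-- ★ **`[K(𝔣𝔭^{n+1}) : K(𝔣𝔭)] = p^n`** (de Shalit II.1.9: `Gal(K(𝔣𝔭^{n+1})/K(𝔣𝔭)) ≅ (1+𝔭)/(1+𝔭^{n+1})`)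
for `K` totally complex, `𝔭` of degree one unramified over `p`, `𝔣 ≠ 0` prime to `𝔭`, `w_{𝔣𝔭} = 1`.
[cite: deShalit1987, II.1.9 (p. 43)] -/
theorem relfinrank_rayClassField_mul_pow_succ (n : ℕ) :
    relfinrank (rayClassField K (𝔣 * v.asIdeal)) (rayClassField K (𝔣 * v.asIdeal ^ (n + 1))) =
      p ^ n := by
  have h := IntermediateField.finrank_bot_mul_relfinrank (rayClassField_mul_le_mul_pow_succ v h𝔣 n)
  rw [finrank_rayClassField_mul_pow_succ_eq v hdeg hval h𝔣 hcop hw n] at h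
  exact Nat.eq_of_mul_eq_mul_left Module.finrank_pos h

/-- `[K(𝔣𝔭^{n+1}) : K(𝔣𝔭)] = p^n`, as the degree of `K(𝔣𝔭^{n+1})` over `K(𝔣𝔭)` (extended scalars).
[cite: deShalit1987, II.1.9 (p. 43)] -/
theorem finrank_extendScalars_rayClassField_mul_pow_succ (n : ℕ) :
    finrank (rayClassField K (𝔣 * v.asIdeal))
      (extendScalars (rayClassField_mul_le_mul_pow_succ v h𝔣 n)) = p ^ n := by
  rw [← IntermediateField.relfinrank_eq_finrank_of_le,
    relfinrank_rayClassField_mul_pow_succ v hdeg hval h𝔣 hcop hw n]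

/-- Consecutive layers: `[K(𝔣𝔭^{n+2}) : K(𝔣𝔭^{n+1})] = p`. [cite: deShalit1987, II.1.9 (p. 43)] -/
theorem relfinrank_rayClassField_mul_pow_succ_succ (n : ℕ) :
    relfinrank (rayClassField K (𝔣 * v.asIdeal ^ (n + 1)))
      (rayClassField K (𝔣 * v.asIdeal ^ (n + 2))) = p := by
  have h := IntermediateField.finrank_bot_mul_relfinrank (rayClassField_mul_pow_succ_le_succ v h𝔣 n)
  rw [finrank_rayClassField_mul_pow_succ_eq v hdeg hval h𝔣 hcop hw n,
    finrank_rayClassField_mul_pow_succ_eq v hdeg hval h𝔣 hcop hw (n + 1), pow_succ p n, ← mul_assoc] at h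
  have hpos : 0 < finrank K (rayClassField K (𝔣 * v.asIdeal)) * p ^ n :=
    Nat.mul_pos Module.finrank_pos (pow_pos (Fact.out : p.Prime).pos n)
  exact Nat.eq_of_mul_eq_mul_left hpos h

/-- ★ **Galois form: `[Gal(K̄/K(𝔣𝔭)) : Gal(K̄/K(𝔣𝔭^{n+1}))] = p^n`** inside `Gal(K̄/K)` — the relative
index of the fixing subgroups of the ray class fields in `AlgebraicClosure K ≃ₐ[K] AlgebraicClosure K`
(the `hidx` hypothesis of `SubgroupTower.exists_toZModPow_character_eq_of_relIndex` for the tower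
`U n = Gal(K̄/K(𝔣𝔭^{n+1}))`). [cite: deShalit1987, II.1.9 (p. 43), II.4.6 (p. 59)] -/
theorem relIndex_fixingSubgroup_rayClassField_mul_pow_succ (n : ℕ) :
    (rayClassField K (𝔣 * v.asIdeal ^ (n + 1))).fixingSubgroup.relIndex
      (rayClassField K (𝔣 * v.asIdeal)).fixingSubgroup = p ^ n := by
  haveI : IsGalois K (AlgebraicClosure K) := {}
  rw [Literature.AnabelianGeometry.EtaleTheta.SettingGalois.relIndex_fixingSubgroup_eq_finrank
    (rayClassField_mul_le_mul_pow_succ v h𝔣 n)]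
  exact finrank_extendScalars_rayClassField_mul_pow_succ v hdeg hval h𝔣 hcop hw n

/-- Galois form between consecutive layers: `[Gal(K̄/K(𝔣𝔭^{n+1})) : Gal(K̄/K(𝔣𝔭^{n+2}))] = p`.
[cite: deShalit1987, II.1.9 (p. 43)] -/
theorem relIndex_fixingSubgroup_rayClassField_mul_pow_succ_succ (n : ℕ) :
    (rayClassField K (𝔣 * v.asIdeal ^ (n + 2))).fixingSubgroup.relIndex
      (rayClassField K (𝔣 * v.asIdeal ^ (n + 1))).fixingSubgroup = p := by
  haveI : IsGalois K (AlgebraicClosure K) := {}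
  rw [Literature.AnabelianGeometry.EtaleTheta.SettingGalois.relIndex_fixingSubgroup_eq_finrank
    (rayClassField_mul_pow_succ_le_succ v h𝔣 n), ← IntermediateField.relfinrank_eq_finrank_of_le]
  exact relfinrank_rayClassField_mul_pow_succ_succ v hdeg hval h𝔣 hcop hw n

end DegreeOne

end Literature.NumberTheory.NumberFields

end
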